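import Mathlib
import Literature.AlgebraicGeometry.Resolution.AffineBlowupRegular
import Literature.AlgebraicGeometry.Resolution.AffineBlowupIntegral
import Literature.AlgebraicGeometry.Resolution.MvPolynomialKillVars

/-!
# `Bl_{(x₀,x₂)} 𝔸⁴` is regular, integral, proper and birational over `𝔸⁴` (programme T, stub S3)

(crux stmt-ResolutionOfSingularities-15640 `WildQuotients.WildQuotientResolution`, line `Sketch`,
programme «INSTANTIATE T1» = `𝔸⁴/(J₂ ⊕ J₂)` of chain w45c; candidate stub S3
`stub_twoBlocks_blowup_regular` of `L/w45c/W45cPlanSignaturesV2.lean` (plan-1), signature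
verbatim; [OURS · L1 W4.5c] — NOT a statement of any manuscript.)

The blow-up `affineBlowup (x₀, x₂)` of `𝔸⁴_k = Spec k[x₀,…,x₃]` in the coordinate plane
`V(x₀, x₂)` (the `σ`-fixed locus of `J₂ ⊕ J₂`) is a regular integral scheme, proper and birational
over `𝔸⁴`: regular by `affineBlowup.isRegular_of_isWeaklyRegular` (`x₀, x₂` is a regular
sequence — `MvPolynomial.isWeaklyRegular_map_X` — and `k[x]/(x₀,x₂) ≅ k[x₁,x₃]` is a regular
ring — `MvPolynomial.quotientSpanXEquiv`), integral (`affineBlowup.isIntegral`), proper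
(`affineBlowup.isProper`) and birational (`affineBlowup.isBirational`) since the centre is a
non-zero ideal of a Noetherian domain.
-/

-- single-problem summit: the doubled namespace component `ResolutionOfSingularities` is forced
set_option linter.dupNamespace false

noncomputable section

open MvPolynomial AlgebraicGeometry CategoryTheory Literature.AlgebraicGeometry.Resolution

namespace Summit.ResolutionOfSingularities.ResolutionOfSingularities.Theorems.WildQuotientResolution.TwoBlocks

/-- The centre `(x₀, x₂) ⊆ k[x₀,…,x₃]` as the span of the range of the pair `![x₀, x₂]` and as
the span of the image of `{0, 2}` under `X`. [folklore] -/
theorem span_pair_eq (k : Type) [Field k] :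
    Ideal.span (Set.range ![(X 0 : MvPolynomial (Fin 4) k), X 2]) =
        Ideal.span {(X 0 : MvPolynomial (Fin 4) k), X 2} ∧
      (Ideal.span (X '' ({0, 2} : Set (Fin 4))) : Ideal (MvPolynomial (Fin 4) k)) =
        Ideal.span {(X 0 : MvPolynomial (Fin 4) k), X 2} := by
  constructor
  · rw [Matrix.range_cons_cons_empty]
  · rw [Set.image_pair]

/-- The centre `(x₀, x₂)` is a non-zero ideal. [folklore] -/
theorem span_pair_ne_bot (k : Type) [Field k] :
    (Ideal.span {(X 0 : MvPolynomial (Fin 4) k), X 2}) ≠ ⊥ := fun h =>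
  MvPolynomial.X_ne_zero (0 : Fin 4)
    ((Ideal.span_eq_bot.mp h) (X 0) (Set.mem_insert _ _))

/-- `k[x₀,…,x₃]/(x₀, x₂)` is a regular ring (it is the polynomial ring `k[x₁, x₃]`,
`MvPolynomial.quotientSpanXEquiv`). [folklore] -/
theorem isRegularRing_quotient_span_pair (k : Type) [Field k] :
    IsRegularRing (MvPolynomial (Fin 4) k ⧸ Ideal.span {(X 0 : MvPolynomial (Fin 4) k), X 2}) := by
  rw [← (span_pair_eq k).2]
  exact IsRegularRing.of_ringEquiv
    (Literature.AlgebraicGeometry.Resolution.MvPolynomial.quotientSpanXEquiv (R := k)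
      ({0, 2} : Set (Fin 4))).toRingEquiv.symm

/-- STUB S3 `stub_twoBlocks_blowup_regular` (M, classical): the blow-up of `𝔸⁴_k` in the
coordinate plane `V(x₀, x₂)` is a regular integral scheme, proper and birational over `𝔸⁴`.
Tools: `affineBlowup.isRegular_of_isWeaklyRegular` (`x₀, x₂` is a regular sequence,
`k[x]/(x₀,x₂) ≅ k[x₁,x₃]` regular), `affineBlowup.isIntegral`, `affineBlowup.isProper`,
`affineBlowup.isBirational`. [cite: Liu2002, Thm. 8.1.19 (a)] [cite: StacksProject, Tag 02OS] -/
theorem stub_twoBlocks_blowup_regular (k : Type) [Field k] :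
    Scheme.IsRegular (affineBlowup (Ideal.span {X 0, X 2} : Ideal (MvPolynomial (Fin 4) k))) ∧
    IsIntegral (affineBlowup (Ideal.span {X 0, X 2} : Ideal (MvPolynomial (Fin 4) k))) ∧
    IsProper (affineBlowup.π (Ideal.span {X 0, X 2} : Ideal (MvPolynomial (Fin 4) k))) ∧
    IsBirational (affineBlowup.π (Ideal.span {X 0, X 2} : Ideal (MvPolynomial (Fin 4) k))) := by
  refine ⟨?_, affineBlowup.isIntegral (span_pair_ne_bot k), inferInstance,
    affineBlowup.isBirational (span_pair_ne_bot k)⟩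
  -- regularity: `x₀, x₂` is a regular sequence with regular quotient
  have hx : RingTheory.Sequence.IsWeaklyRegular (MvPolynomial (Fin 4) k)
      (List.ofFn ![(X 0 : MvPolynomial (Fin 4) k), X 2]) := by
    have h := Literature.AlgebraicGeometry.Resolution.MvPolynomial.isWeaklyRegular_map_X
      (R := k) ([0, 2] : List (Fin 4)) (by decide)
    simpa using h
  haveI : IsRegularRing (MvPolynomial (Fin 4) k ⧸
      Ideal.span (Set.range ![(X 0 : MvPolynomial (Fin 4) k), X 2])) := by
    rw [(span_pair_eq k).1]
    exact isRegularRing_quotient_span_pair k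
  have hreg := affineBlowup.isRegular_of_isWeaklyRegular ![(X 0 : MvPolynomial (Fin 4) k), X 2] hx
  rwa [(span_pair_eq k).1] at hreg

end Summit.ResolutionOfSingularities.ResolutionOfSingularities.Theorems.WildQuotientResolution.TwoBlocks

end
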